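import Summits.CriticalPhenomena.PercolationContinuityZ3.Theorems.PercNearOneGluingNoHeavyLowerTailKNGoodGMgcCert
import HarnessLib

/-!
# THEOREM B — Fourier–Motzkin glue: from the 27 polynomial conditions to the two-multiplier certificate (pure algebra) and
# linearity / sign tools for the Bernoulli expectations `bexp`
# (`NoHeavyLowerTail` cell, stmt-CriticalPhenomena-4575; prover `prim-hp-2`, gen 17)

Support file (`--supports stmt-CriticalPhenomena-4575`).  No new definitions, no named facts, no sorries.
Memo MEMO-gen15-grandchild-certificates.md §3d (the conditions (B·) ARE certificate existence) and the gen-17 memo §4 (S4).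
* `bexp_add`, `bexp_neg`, `bexp_sub` — linearity of `KNGoodGMgc.bexp n · x` in the integrand; `bexp_nonneg_of_check`, `bexp_nonpos_of_check` —
  sign of an expectation from an `SBTens.allNonneg` check of the (negated) vertex tensor (tiny `native_decide`s in the customer file).
* `fm_j1`, `fm_j2`, `fm_j3` — for designee position `j`, with `T = Φ_α α + Φ_β β + Φ_γ γ + Φ_δ δ + Φ_ε ε`: the cone rows of the core scalars
  (`α, β, γ ≥ 0`, `δ ≥ α`, `ε ≥ −β`), the two loneliness rows of `j` (world-law form, memo §3b), the sign pattern of `Φ(j;·)` and the three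
  conditions (B·a), (B·b-d), (B·b-ad) imply `0 ≤ D_j · T` with `D₁ = Q₁₂Q₁₃`, `D₂ = D₃' = Q₁₂Q₂₃(Q_d+Q₂₃)` resp. `D₃ = Q₁₂Q₁₃Q₂₃(Q_d+Q₂₃)`
  — explicit identities `D·T = (cone* pairing) + μ·rows` checked by `ring`, all summands nonnegative.  `D_j > 0` for interior hair weights; the
  boundary is the semantic layer's business (continuity, or the structural vanishing `Q₁₃ = 0 ⇒ Φ_γ = 0` etc.).
-/

namespace Summit.CriticalPhenomena.PercolationContinuityZ3.Theorems

namespace KNGoodGMgc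

open SBTens

/-! ## Linearity and signs of `bexp` -/

/-- `bexp` is additive in the integrand. [folklore] -/
theorem bexp_add : ∀ (n : ℕ) (f g : Cfg → ℤ) (x : ℕ → ℝ), bexp n (fun c => f c + g c) x = bexp n f x + bexp n g x
  | 0, f, g, x => by simp [bexp_zero]
  | n + 1, f, g, x => by
    rw [bexp_succ, bexp_succ, bexp_succ, bexp_add n, bexp_add n]; ring

/-- `bexp` of a negated integrand. [folklore] -/
theorem bexp_neg : ∀ (n : ℕ) (f : Cfg → ℤ) (x : ℕ → ℝ), bexp n (fun c => -f c) x = -bexp n f x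
  | 0, f, x => by simp [bexp_zero]
  | n + 1, f, x => by
    rw [bexp_succ, bexp_succ, bexp_neg n, bexp_neg n]; ring

/-- `bexp` of a difference. [folklore] -/
theorem bexp_sub (n : ℕ) (f g : Cfg → ℤ) (x : ℕ → ℝ) : bexp n (fun c => f c - g c) x = bexp n f x - bexp n g x := by
  have h := bexp_add n f (fun c => -g c) x
  rw [bexp_neg] at h
  simpa [sub_eq_add_neg] using h

/-- Sign of an expectation from a coefficient check: all vertex values `≥ 0`. [folklore] -/
theorem bexp_nonneg_of_check (n : ℕ) (f : Cfg → ℤ) (h : allNonneg n (ofFn n f) = true) (x : ℕ → ℝ)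
    (hx : ∀ i, 0 ≤ x i ∧ x i ≤ 1) : 0 ≤ bexp n f x :=
  eval_nonneg n _ x hx h

/-- Sign of an expectation from a coefficient check on the negated tensor. [folklore] -/
theorem bexp_nonpos_of_check (n : ℕ) (f : Cfg → ℤ) (h : allNonneg n (smul n (-1) (ofFn n f)) = true) (x : ℕ → ℝ)
    (hx : ∀ i, 0 ≤ x i ∧ x i ≤ 1) : bexp n f x ≤ 0 := by
  have h1 := eval_nonneg n _ x hx h
  rw [(smul_spec n _ (-1) (ofFn n f) (WF_ofFn n f)).2 x] at h1
  have : eval n (ofFn n f) x = bexp n f x := rfl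
  rw [this] at h1
  push_cast at h1
  linarith

/-! ## Fourier–Motzkin, multiplied out (pure real algebra) -/

section FM
variable (Φa Φb Φg Φd Φe Qd Q12 Q13 Q23 α β γ δ ε : ℝ)

/-- **`j = 1`** (designee = core-bottom relay).  Rows of `j`: `hyp₂ = Q_dα − Q₁₃γ + Q₂₃δ ≥ 0`, `hyp₃ = Q_d(α+β) − Q₁₂ε + Q₂₃δ ≥ 0`;
signs `Φ_γ, Φ_ε ≤ 0`; (B1a) `0 ≤ Φ_βQ₁₂ + Φ_εQ_d`; (B1b-d) `0 ≤ Φ_δQ₁₃Q₁₂ + Φ_γQ₁₂Q₂₃ + Φ_εQ₁₃Q₂₃`; (B1b-ad) the same with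
`Φ_α+Φ_δ`, `Q_d+Q₂₃`.  Conclusion `0 ≤ Q₁₂Q₁₃·T` (multipliers `λ₂ = −Φ_γ/Q₁₃`, `λ₃ = −Φ_ε/Q₁₂`, cleared of denominators). [this work] -/
theorem fm_j1 (hQ12 : 0 ≤ Q12) (hQ13 : 0 ≤ Q13) (hα : 0 ≤ α) (hβ : 0 ≤ β) (hδ : α ≤ δ)
    (sg : Φg ≤ 0) (se : Φe ≤ 0)
    (h2 : 0 ≤ Qd * α - Q13 * γ + Q23 * δ) (h3 : 0 ≤ Qd * (α + β) - Q12 * ε + Q23 * δ)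
    (Ba : 0 ≤ Φb * Q12 + Φe * Qd)
    (Bd : 0 ≤ Φd * Q13 * Q12 + Φg * Q12 * Q23 + Φe * Q13 * Q23)
    (Bad : 0 ≤ (Φa + Φd) * Q13 * Q12 + Φg * Q12 * (Qd + Q23) + Φe * Q13 * (Qd + Q23)) :
    0 ≤ Q12 * Q13 * (Φa * α + Φb * β + Φg * γ + Φd * δ + Φe * ε) := by
  have key : Q12 * Q13 * (Φa * α + Φb * β + Φg * γ + Φd * δ + Φe * ε) =
      ((Φa + Φd) * Q13 * Q12 + Φg * Q12 * (Qd + Q23) + Φe * Q13 * (Qd + Q23)) * α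
      + (Φd * Q13 * Q12 + Φg * Q12 * Q23 + Φe * Q13 * Q23) * (δ - α)
      + Q13 * (Φb * Q12 + Φe * Qd) * β
      + (-Φg * Q12) * (Qd * α - Q13 * γ + Q23 * δ)
      + (-Φe * Q13) * (Qd * (α + β) - Q12 * ε + Q23 * δ) := by ring
  rw [key]
  have hδ' : 0 ≤ δ - α := sub_nonneg.2 hδ
  refine add_nonneg (add_nonneg (add_nonneg (add_nonneg ?_ ?_) ?_) ?_) ?_
  · exact mul_nonneg Bad hα
  · exact mul_nonneg Bd hδ'
  · exact mul_nonneg (mul_nonneg hQ13 Ba) hβ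
  · exact mul_nonneg (mul_nonneg (by linarith) hQ12) h2
  · exact mul_nonneg (mul_nonneg (by linarith) hQ13) h3

/-- **`j = 2`** (designee = core-middle relay).  Rows of `j`: `hyp₁ = −Q_dα + Q₁₃γ − Q₂₃δ ≥ 0`, `hyp₃ = Q_dβ − Q₁₂ε + Q₁₃γ ≥ 0`; signs
`Φ_δ ≤ 0`, `Φ_α + Φ_δ ≤ 0`, `Φ_ε ≤ 0`; (B2a) `0 ≤ Φ_βQ₁₂ + Φ_εQ_d`; (B2b-d) `0 ≤ Φ_γQ₂₃Q₁₂ + Φ_δQ₁₂Q₁₃ + Φ_εQ₂₃Q₁₃`; (B2b-ad) the same with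
`Φ_α+Φ_δ`, `Q_d+Q₂₃`.  Conclusion `0 ≤ Q₁₂Q₂₃(Q_d+Q₂₃)·T` (case split on which lower bound of `λ₁` is active). [this work] -/
theorem fm_j2 (hQd : 0 ≤ Qd) (hQ12 : 0 ≤ Q12) (hQ23 : 0 ≤ Q23) (hα : 0 ≤ α) (hβ : 0 ≤ β) (hγ : 0 ≤ γ) (hδ : α ≤ δ)
    (sd : Φd ≤ 0) (sad : Φa + Φd ≤ 0) (se : Φe ≤ 0)
    (h1 : 0 ≤ -Qd * α + Q13 * γ - Q23 * δ) (h3 : 0 ≤ Qd * β - Q12 * ε + Q13 * γ)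
    (Ba : 0 ≤ Φb * Q12 + Φe * Qd)
    (Bd : 0 ≤ Φg * Q23 * Q12 + Φd * Q12 * Q13 + Φe * Q23 * Q13)
    (Bad : 0 ≤ Φg * (Qd + Q23) * Q12 + (Φa + Φd) * Q12 * Q13 + Φe * (Qd + Q23) * Q13) :
    0 ≤ Q12 * Q23 * (Qd + Q23) * (Φa * α + Φb * β + Φg * γ + Φd * δ + Φe * ε) := by
  have hδ' : 0 ≤ δ - α := sub_nonneg.2 hδ
  rcases le_total (Φd * Qd) (Φa * Q23) with hc | hc
  · -- branch d active: λ₁ = −Φ_δ/Q₂₃, D = Q₂₃Q₁₂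
    have key : Q12 * Q23 * (Qd + Q23) * (Φa * α + Φb * β + Φg * γ + Φd * δ + Φe * ε) = (Qd + Q23) *
        (Q12 * (Q23 * Φa - Φd * Qd) * α + Q23 * (Φb * Q12 + Φe * Qd) * β
          + (Φg * Q23 * Q12 + Φd * Q12 * Q13 + Φe * Q23 * Q13) * γ
          + (-Φd * Q12) * (-Qd * α + Q13 * γ - Q23 * δ) + (-Φe * Q23) * (Qd * β - Q12 * ε + Q13 * γ)) := by ring
    rw [key]
    refine mul_nonneg (add_nonneg hQd hQ23) (add_nonneg (add_nonneg (add_nonneg (add_nonneg ?_ ?_) ?_) ?_) ?_)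
    · exact mul_nonneg (mul_nonneg hQ12 (by linarith)) hα
    · exact mul_nonneg (mul_nonneg hQ23 Ba) hβ
    · exact mul_nonneg Bd hγ
    · exact mul_nonneg (mul_nonneg (by linarith) hQ12) h1
    · exact mul_nonneg (mul_nonneg (by linarith) hQ23) h3
  · -- branch ad active: λ₁ = −(Φ_α+Φ_δ)/(Q_d+Q₂₃), D = (Q_d+Q₂₃)Q₁₂
    have key : Q12 * Q23 * (Qd + Q23) * (Φa * α + Φb * β + Φg * γ + Φd * δ + Φe * ε) = Q23 *
        (Q12 * (Qd * Φd - Φa * Q23) * (δ - α) + (Qd + Q23) * (Φb * Q12 + Φe * Qd) * β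
          + (Φg * (Qd + Q23) * Q12 + (Φa + Φd) * Q12 * Q13 + Φe * (Qd + Q23) * Q13) * γ
          + (-(Φa + Φd) * Q12) * (-Qd * α + Q13 * γ - Q23 * δ) + (-Φe * (Qd + Q23)) * (Qd * β - Q12 * ε + Q13 * γ)) := by
      ring
    rw [key]
    refine mul_nonneg hQ23 (add_nonneg (add_nonneg (add_nonneg (add_nonneg ?_ ?_) ?_) ?_) ?_)
    · exact mul_nonneg (mul_nonneg hQ12 (by linarith)) hδ'
    · exact mul_nonneg (mul_nonneg (add_nonneg hQd hQ23) Ba) hβ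
    · exact mul_nonneg Bad hγ
    · exact mul_nonneg (mul_nonneg (by linarith) hQ12) h1
    · exact mul_nonneg (mul_nonneg (by linarith) (add_nonneg hQd hQ23)) h3

/-- **`j = 3`** (designee = core-top relay).  Rows of `j`: `hyp₁ = −Q_d(α+β) + Q₁₂ε − Q₂₃δ ≥ 0`, `hyp₂ = −Q_dβ + Q₁₂ε − Q₁₃γ ≥ 0`; signs
`Φ_δ ≤ 0`, `Φ_α + Φ_δ ≤ 0`, `Φ_γ ≤ 0`; (B3a) `0 ≤ Φ_εQ_d + Φ_βQ₁₂`; (B3b-d) `0 ≤ Φ_εQ₂₃Q₁₃ + Φ_δQ₁₃Q₁₂ + Φ_γQ₂₃Q₁₂`; (B3b-ad) the same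
with `Φ_α+Φ_δ`, `Q_d+Q₂₃`.  Conclusion `0 ≤ Q₁₂Q₁₃Q₂₃(Q_d+Q₂₃)·T` (`λ₁+λ₂ = Φ_ε/Q₁₂`, case split on `λ₁`). [this work] -/
theorem fm_j3 (hQd : 0 ≤ Qd) (hQ12 : 0 ≤ Q12) (hQ13 : 0 ≤ Q13) (hQ23 : 0 ≤ Q23) (hα : 0 ≤ α) (hβ : 0 ≤ β) (hγ : 0 ≤ γ)
    (hδ : α ≤ δ) (sd : Φd ≤ 0) (sad : Φa + Φd ≤ 0) (sg : Φg ≤ 0)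
    (h1 : 0 ≤ -Qd * (α + β) + Q12 * ε - Q23 * δ) (h2 : 0 ≤ -Qd * β + Q12 * ε - Q13 * γ)
    (Ba : 0 ≤ Φe * Qd + Φb * Q12)
    (Bd : 0 ≤ Φe * Q23 * Q13 + Φd * Q13 * Q12 + Φg * Q23 * Q12)
    (Bad : 0 ≤ Φe * (Qd + Q23) * Q13 + (Φa + Φd) * Q13 * Q12 + Φg * (Qd + Q23) * Q12) :
    0 ≤ Q12 * Q13 * Q23 * (Qd + Q23) * (Φa * α + Φb * β + Φg * γ + Φd * δ + Φe * ε) := by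
  have hδ' : 0 ≤ δ - α := sub_nonneg.2 hδ
  rcases le_total (Φd * Qd) (Φa * Q23) with hc | hc
  · -- branch d active: λ₁ = −Φ_δ/Q₂₃, D = Q₂₃Q₁₂Q₁₃
    have key : Q12 * Q13 * Q23 * (Qd + Q23) * (Φa * α + Φb * β + Φg * γ + Φd * δ + Φe * ε) = (Qd + Q23) *
        (Q12 * Q13 * (Q23 * Φa - Φd * Qd) * α + Q23 * Q13 * (Φe * Qd + Φb * Q12) * β
          + Q13 * (Φe * Q23 * Q13 + Φd * Q13 * Q12 + Φg * Q23 * Q12) * γ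
          + (-Φd * Q12 * Q13) * (-Qd * (α + β) + Q12 * ε - Q23 * δ)
          + ((Φe * Q23 * Q13 + Φd * Q13 * Q12 + Φg * Q23 * Q12) + (-Φg) * Q23 * Q12) * (-Qd * β + Q12 * ε - Q13 * γ)) := by
      ring
    rw [key]
    refine mul_nonneg (add_nonneg hQd hQ23) (add_nonneg (add_nonneg (add_nonneg (add_nonneg ?_ ?_) ?_) ?_) ?_)
    · exact mul_nonneg (mul_nonneg (mul_nonneg hQ12 hQ13) (by linarith)) hα
    · exact mul_nonneg (mul_nonneg (mul_nonneg hQ23 hQ13) Ba) hβ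
    · exact mul_nonneg (mul_nonneg hQ13 Bd) hγ
    · exact mul_nonneg (mul_nonneg (mul_nonneg (by linarith) hQ12) hQ13) h1
    · exact mul_nonneg (add_nonneg Bd (mul_nonneg (mul_nonneg (by linarith) hQ23) hQ12)) h2
  · -- branch ad active: λ₁ = −(Φ_α+Φ_δ)/(Q_d+Q₂₃), D = (Q_d+Q₂₃)Q₁₂Q₁₃
    have key : Q12 * Q13 * Q23 * (Qd + Q23) * (Φa * α + Φb * β + Φg * γ + Φd * δ + Φe * ε) = Q23 *
        (Q12 * Q13 * (Qd * Φd - Φa * Q23) * (δ - α) + (Qd + Q23) * Q13 * (Φe * Qd + Φb * Q12) * β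
          + Q13 * (Φe * (Qd + Q23) * Q13 + (Φa + Φd) * Q13 * Q12 + Φg * (Qd + Q23) * Q12) * γ
          + (-(Φa + Φd) * Q12 * Q13) * (-Qd * (α + β) + Q12 * ε - Q23 * δ)
          + ((Φe * (Qd + Q23) * Q13 + (Φa + Φd) * Q13 * Q12 + Φg * (Qd + Q23) * Q12) + (-Φg) * (Qd + Q23) * Q12) *
              (-Qd * β + Q12 * ε - Q13 * γ)) := by
      ring
    rw [key]
    refine mul_nonneg hQ23 (add_nonneg (add_nonneg (add_nonneg (add_nonneg ?_ ?_) ?_) ?_) ?_)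
    · exact mul_nonneg (mul_nonneg (mul_nonneg hQ12 hQ13) (by linarith)) hδ'
    · exact mul_nonneg (mul_nonneg (mul_nonneg (add_nonneg hQd hQ23) hQ13) Ba) hβ
    · exact mul_nonneg (mul_nonneg hQ13 Bad) hγ
    · exact mul_nonneg (mul_nonneg (mul_nonneg (by linarith) hQ12) hQ13) h1
    · exact mul_nonneg (add_nonneg Bad (mul_nonneg (mul_nonneg (by linarith) (add_nonneg hQd hQ23)) hQ12)) h2

end FM

end KNGoodGMgc

end Summit.CriticalPhenomena.PercolationContinuityZ3.Theorems
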